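import Literature.RepresentationTheory.Kovacevic2021.SU21SubquotientModule
import Literature.RepresentationTheory.Kovacevic2021.SU21PrincipalSeriesSubquotients
import Literature.RepresentationTheory.Kovacevic2021.SU21ModelRecognition
import Literature.RepresentationTheory.Kovacevic2021.SU21PrincipalSeriesCohomologicalPoints
import HarnessLib

/-!
# The composition factors of `V(−3/2, 6)` and `V(−3/2, −6)`: `D_2 | J_{1,0} | D_1` and `D_0 | J_{0,1} | D_1`

Companion of `…Kovacevic2021.SU21PrincipalSeriesCompositionFactors` (the factors of `V(0,0)`), with the same inputs:
`…SU21PrincipalSeriesSubquotients` (subquotients of `V(c,2t)` whose `K`-types form a product cell are strongly connected),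
`…SU21SubquotientModule` (`N₂ ⧸ (N₁ ⊓ N₂) ≃ (subquotient datum).V`), `…SU21ModelRecognition` (recognition of the six
modules by their `K`-types) and `…SU21PrincipalSeriesCohomologicalPoints` §2–§3
(the Lie span of a single `K`-type of `V(−3/2,±6)` is a strip `q ≤ q₀` / `p ≤ p₀` or everything; the root lines cut the
cone into the `K`-type supports of `U(0,±6)`, `Z(±3)`, `W(3,0)`).

**What is proved** — AS `𝔤𝔩(3,ℂ)`-MODULES, up to isomorphism [BorelWallach2000, VI 4.10 (10)] [Kovacevic2021, §4]:
* `V(−3/2, 6)` (the principal series containing the holomorphic discrete series): with `N_ray = ⟨V_{1,6}⟩` (the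
  `K`-types `V_{1+p, 6+3p}`) and `N_strip = ⟨V_{2,3}⟩` (the `K`-types with `q ≤ 1`),
  `N_ray ≅ U(0,6) = holDS` (`hol_ray_factor`), `N_strip ⧸ N_ray ≅ Z(3) = ladderPlus` (`hol_strip_factor`),
  `V(−3/2,6) ⧸ N_strip ≅ W(3,0) = midDS` (`hol_top_factor`);
* `V(−3/2, −6)` symmetrically: `N_ray' = ⟨V_{1,−6}⟩ ≅ U(0,−6) = antiholDS` (`antihol_ray_factor`),
  `N_strip' ⧸ N_ray' ≅ Z(−3) = ladderMinus` with `N_strip' = ⟨V_{2,−3}⟩` (`antihol_strip_factor`),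
  `V(−3/2,−6) ⧸ N_strip' ≅ W(3,0) = midDS` (`antihol_top_factor`);
each factor irreducible, the quotients being by `ker sqHom = N₁.comap N₂.incl` (`SU21SubquotientModule.ker_sqHom`).

DEFINITIONS (with bodies): `spanHolRay`, `spanHolStrip`, `spanAntiholRay`, `spanAntiholStrip`.  No named facts.

## References

* D. Kovačević, *Unitary `(𝔤,K)` modules of `SU(2,1)`*, Acta Math. Spalatensia 1 (2021) 105–125
  (arXiv:1810.01752): §3 Thm 3, Remark 6; §4 (`U(0,±6)`, `Z(±3)`, `W(3,0)`, `c(l,t)`). [Kovacevic2021]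
* A. Borel, N. Wallach (2000), VI 4.8, 4.10 (10), Thm 4.11 pp. 131–132. [BorelWallach2000]
-/

noncomputable section

namespace Literature.RepresentationTheory.Kovacevic2021

-- Mathlib idiom (Mathlib/Algebra/Lie/OfAssociative.lean): commutator brackets on associative algebras; needed for
-- the `𝔤𝔩(3,ℂ)`-module structure on `𝒟.V`, as in every file of this directory.
attribute [local instance 100] LieRing.ofAssociativeRing

namespace SU21Datum

open PrincipalSeries

/-! ## §1 `V(−3/2, 6)`: `D_2 | J_{1,0} | D_1` -/

/-- `N_ray = ⟨u^1_{1,6}⟩ ⊆ V(−3/2,6)`: generated by the vertex; its `K`-types are the ray `q = 0` (`V_{1+p,6+3p}`).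
[cite: Kovacevic2021, §4 (`U(0,6)`)] [cite: BorelWallach2000, VI 4.10 (10)] -/
def spanHolRay : LieSubmodule ℂ (Matrix (Fin 3) (Fin 3) ℂ) (principalSeries (-3 / 2) 3).V :=
  LieSubmodule.lieSpan ℂ (Matrix (Fin 3) (Fin 3) ℂ)
    {(principalSeries (-3 / 2) 3).vec (1 + 0 + 0) (2 * 3 + 3 * 0 - 3 * 0) 1}

/-- `N_strip = ⟨u^1_{2,3}⟩ ⊆ V(−3/2,6)`: generated by `V_{2,3}` (`(p,q) = (0,1)`); its `K`-types are the strip `q ≤ 1`.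
[cite: Kovacevic2021, §3 proof of Thm 3 ("a strip"), §4 (`Z(3)`)] [cite: BorelWallach2000, VI 4.10 (10)] -/
def spanHolStrip : LieSubmodule ℂ (Matrix (Fin 3) (Fin 3) ℂ) (principalSeries (-3 / 2) 3).V :=
  LieSubmodule.lieSpan ℂ (Matrix (Fin 3) (Fin 3) ℂ)
    {(principalSeries (-3 / 2) 3).vec (1 + 0 + 1) (2 * 3 + 3 * 0 - 3 * 1) 1}

/-- a cone point of `V(−3/2,6)` is a `K`-type [cite: Kovacevic2021, §3 Thm 3] -/
private theorem memHol {p q : ℤ} (hp : 0 ≤ p) (hq : 0 ≤ q) :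
    ((1 + p + q, 2 * 3 + 3 * p - 3 * q) : ℤ × ℤ) ∈ (principalSeries (-3 / 2) 3).S :=
  mem_cone hp hq rfl rfl

/-- the `K`-types of the sub-datum `N_ray`: the ray `q = 0` [cite: Kovacevic2021, §4 (`U(0,6)`)] -/
theorem hol_ray_mem_iff {p q : ℤ} (hp : 0 ≤ p) (hq : 0 ≤ q) :
    ((1 + p + q, 2 * 3 + 3 * p - 3 * q) : ℤ × ℤ) ∈ (principalSeries (-3 / 2) 3).sqSet ⊥ spanHolRay ↔
      p ∈ Set.Ici (0 : ℤ) ∧ q ∈ ({0} : Set ℤ) := by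
  rw [mem_sqSet_bot_iff, spanHolRay, principalSeries_hol_vec_mem_lieSpan_iff (p₀ := 0) (q₀ := 0) le_rfl le_rfl hp hq,
    Set.mem_Ici, Set.mem_singleton_iff, and_iff_right (memHol hp hq)]
  omega

/-- **`D_2 = U(0,6)`: the vertex of `V(−3/2,6)` generates the holomorphic discrete series** — the sub-datum of `N_ray`
has the `K`-types of `holDS`, is irreducible, and `N_ray ≃ holDS.V` as `𝔤𝔩(3,ℂ)`-modules.
[cite: Kovacevic2021, §4 (`U(0,6)`)] [cite: BorelWallach2000, VI 4.10 (10) (`D_2`)] -/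
theorem hol_ray_factor :
    ((principalSeries (-3 / 2) 3).subquotient ⊥ spanHolRay).S = holDS.S ∧
      LieModule.IsIrreducible ℂ (Matrix (Fin 3) (Fin 3) ℂ) ((principalSeries (-3 / 2) 3).subquotient ⊥ spanHolRay).V ∧
      Nonempty (spanHolRay ≃ₗ⁅ℂ, Matrix (Fin 3) (Fin 3) ℂ⁆ holDS.V) := by
  have hmem := fun p q (hp : (0 : ℤ) ≤ p) (hq : (0 : ℤ) ≤ q) => hol_ray_mem_iff hp hq
  have hS : ((principalSeries (-3 / 2) 3).subquotient ⊥ spanHolRay).S = holDS.S :=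
    subquotient_principalSeries_S_eq hmem fun n m => by
      rw [mem_holDS]
      simp only [Set.mem_Ici, Set.mem_singleton_iff]
      constructor
      · rintro ⟨h1, h2⟩; exact ⟨n - 1, 0, by omega, le_rfl, by omega, by omega, by omega, rfl⟩
      · rintro ⟨p, q, hp, -, rfl, rfl, -, rfl⟩; omega
  have hconn := subquotient_principalSeries_reach Set.ordConnected_Ici Set.ordConnected_singleton
    (fun p hp => by simpa only [Set.mem_Ici] using hp) (by simp) hmem
    (fun p hp _ => acoef_hol_ne_zero (by simpa only [Set.mem_Ici] using hp))
    (fun q hq hq1 => by simp only [Set.mem_singleton_iff] at hq hq1; omega)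
  obtain ⟨e⟩ := nonempty_equiv_holDS_of_S_eq hS hconn
    fun m h => subquotient_principalSeries_casimirScalar (by norm_num) h
  exact ⟨hS, isIrreducible_of_forall_reach (by rw [hS]; exact ⟨(1, 6), (mem_holDS 1 6).2 ⟨le_rfl, by norm_num⟩⟩) hconn,
    ⟨(sqEquivOfBot _ _).trans e⟩⟩

/-- the `K`-types of `N_strip ⧸ N_ray`: the row `q = 1` [cite: Kovacevic2021, §3 proof of Thm 3, §4 (`Z(3)`)] -/
theorem hol_strip_mem_iff {p q : ℤ} (hp : 0 ≤ p) (hq : 0 ≤ q) :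
    ((1 + p + q, 2 * 3 + 3 * p - 3 * q) : ℤ × ℤ) ∈ (principalSeries (-3 / 2) 3).sqSet spanHolRay spanHolStrip ↔
      p ∈ Set.Ici (0 : ℤ) ∧ q ∈ ({1} : Set ℤ) := by
  rw [mem_sqSet_iff, spanHolStrip, spanHolRay,
    principalSeries_hol_vec_mem_lieSpan_iff (p₀ := 0) (q₀ := 1) le_rfl zero_le_one hp hq,
    principalSeries_hol_vec_mem_lieSpan_iff (p₀ := 0) (q₀ := 0) le_rfl le_rfl hp hq, Set.mem_Ici,
    Set.mem_singleton_iff, and_iff_right (memHol hp hq)]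
  omega

/-- **`J_{1,0} = Z(3)` is the composition factor `N_strip ⧸ N_ray` of `V(−3/2,6)`** (quotient by
`ker sqHom = N_ray.comap N_strip.incl`). [cite: Kovacevic2021, §4 (`Z(3)`)] [cite: BorelWallach2000, VI 4.10 (10) (`J_{1,0}`)] -/
theorem hol_strip_factor :
    ((principalSeries (-3 / 2) 3).subquotient spanHolRay spanHolStrip).S = ladderPlus.S ∧
      LieModule.IsIrreducible ℂ (Matrix (Fin 3) (Fin 3) ℂ)
        ((principalSeries (-3 / 2) 3).subquotient spanHolRay spanHolStrip).V ∧
      Nonempty ((spanHolStrip ⧸ ((principalSeries (-3 / 2) 3).sqHom spanHolRay spanHolStrip).ker) ≃ₗ⁅ℂ,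
        Matrix (Fin 3) (Fin 3) ℂ⁆ ladderPlus.V) := by
  have hmem := fun p q (hp : (0 : ℤ) ≤ p) (hq : (0 : ℤ) ≤ q) => hol_strip_mem_iff hp hq
  have hS : ((principalSeries (-3 / 2) 3).subquotient spanHolRay spanHolStrip).S = ladderPlus.S :=
    subquotient_principalSeries_S_eq hmem fun n m => by
      rw [mem_ladderPlus]
      simp only [Set.mem_Ici, Set.mem_singleton_iff]
      constructor
      · rintro ⟨h1, h2⟩; exact ⟨n - 2, 1, by omega, zero_le_one, by omega, by omega, by omega, rfl⟩
      · rintro ⟨p, q, hp, -, rfl, rfl, -, rfl⟩; omega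
  have hconn := subquotient_principalSeries_reach Set.ordConnected_Ici Set.ordConnected_singleton
    (fun p hp => by simpa only [Set.mem_Ici] using hp) (by simp) hmem
    (fun p hp _ => acoef_hol_ne_zero (by simpa only [Set.mem_Ici] using hp))
    (fun q hq hq1 => by simp only [Set.mem_singleton_iff] at hq hq1; omega)
  obtain ⟨e⟩ := nonempty_equiv_ladderPlus_of_S_eq hS hconn
  exact ⟨hS, isIrreducible_of_forall_reach (by rw [hS]; exact ⟨(2, 3), (mem_ladderPlus 2 3).2 ⟨le_rfl, by norm_num⟩⟩)
    hconn, ⟨(sqEquiv _ _ _).trans e⟩⟩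

/-- the `K`-types of `V(−3/2,6) ⧸ N_strip`: `q ≥ 2` [cite: Kovacevic2021, §3 proof of Thm 3, §4 (`W(3,0)`)] -/
theorem hol_top_mem_iff {p q : ℤ} (hp : 0 ≤ p) (hq : 0 ≤ q) :
    ((1 + p + q, 2 * 3 + 3 * p - 3 * q) : ℤ × ℤ) ∈ (principalSeries (-3 / 2) 3).sqSet spanHolStrip ⊤ ↔
      p ∈ Set.Ici (0 : ℤ) ∧ q ∈ Set.Ici (2 : ℤ) := by
  rw [mem_sqSet_top_iff, spanHolStrip,
    principalSeries_hol_vec_mem_lieSpan_iff (p₀ := 0) (q₀ := 1) le_rfl zero_le_one hp hq, Set.mem_Ici, Set.mem_Ici,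
    and_iff_right (memHol hp hq)]
  omega

/-- **`D_1 = W(3,0)` is the top composition factor `V(−3/2,6) ⧸ N_strip`** (every `K`-type with `q ≥ 2` generates
`V(−3/2,6)`). [cite: Kovacevic2021, §4 (`W(3,0)`)] [cite: BorelWallach2000, VI 4.10 (10) (`D_1`)] -/
theorem hol_top_factor :
    ((principalSeries (-3 / 2) 3).subquotient spanHolStrip ⊤).S = midDS.S ∧
      LieModule.IsIrreducible ℂ (Matrix (Fin 3) (Fin 3) ℂ) ((principalSeries (-3 / 2) 3).subquotient spanHolStrip ⊤).V ∧
      Nonempty (((⊤ : LieSubmodule ℂ (Matrix (Fin 3) (Fin 3) ℂ) (principalSeries (-3 / 2) 3).V) ⧸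
          ((principalSeries (-3 / 2) 3).sqHom spanHolStrip ⊤).ker) ≃ₗ⁅ℂ, Matrix (Fin 3) (Fin 3) ℂ⁆ midDS.V) := by
  have hmem := fun p q (hp : (0 : ℤ) ≤ p) (hq : (0 : ℤ) ≤ q) => hol_top_mem_iff hp hq
  have hS : ((principalSeries (-3 / 2) 3).subquotient spanHolStrip ⊤).S = midDS.S :=
    subquotient_principalSeries_S_eq hmem fun n m => by
      rw [mem_midDS_iff_int]
      simp only [Set.mem_Ici]
      constructor
      · rintro ⟨p, q, hp, hq, rfl, rfl⟩; exact ⟨p - 1, q + 1, by omega, by omega, by omega, by omega, by omega, by omega⟩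
      · rintro ⟨p, q, -, -, rfl, rfl, hp, hq⟩; exact ⟨p + 1, q - 1, by omega, by omega, by omega, by omega⟩
  have hconn := subquotient_principalSeries_reach Set.ordConnected_Ici Set.ordConnected_Ici
    (fun p hp => by simpa only [Set.mem_Ici] using hp) (fun q hq => by simp only [Set.mem_Ici] at hq; omega) hmem
    (fun p hp _ => acoef_hol_ne_zero (by simpa only [Set.mem_Ici] using hp))
    (fun q hq _ => by rw [Set.mem_Ici] at hq; rw [Ne, bcoef_hol_eq_zero_iff (by omega)]; omega)
  obtain ⟨e⟩ := nonempty_equiv_midDS_of_S_eq hS hconn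
  exact ⟨hS, isIrreducible_of_forall_reach
    (by rw [hS]; exact ⟨(3, 0), (mem_midDS_iff_int 3 0).2 ⟨1, 1, le_rfl, le_rfl, by norm_num, by norm_num⟩⟩) hconn,
    ⟨(sqEquiv _ _ _).trans e⟩⟩

/-! ## §2 `V(−3/2, −6)`: `D_0 | J_{0,1} | D_1` -/

/-- `N_ray' = ⟨u^1_{1,−6}⟩ ⊆ V(−3/2,−6)`: generated by the vertex; its `K`-types are the ray `p = 0`
(`V_{1+q,−6−3q}`). [cite: Kovacevic2021, §4 (`U(0,−6)`)] [cite: BorelWallach2000, VI 4.10 (10)] -/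
def spanAntiholRay : LieSubmodule ℂ (Matrix (Fin 3) (Fin 3) ℂ) (principalSeries (-3 / 2) (-3)).V :=
  LieSubmodule.lieSpan ℂ (Matrix (Fin 3) (Fin 3) ℂ)
    {(principalSeries (-3 / 2) (-3)).vec (1 + 0 + 0) (2 * (-3) + 3 * 0 - 3 * 0) 1}

/-- `N_strip' = ⟨u^1_{2,−3}⟩ ⊆ V(−3/2,−6)`: generated by `V_{2,−3}` (`(p,q) = (1,0)`); its `K`-types are the strip
`p ≤ 1`. [cite: Kovacevic2021, §3 proof of Thm 3, §4 (`Z(−3)`)] [cite: BorelWallach2000, VI 4.10 (10)] -/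
def spanAntiholStrip : LieSubmodule ℂ (Matrix (Fin 3) (Fin 3) ℂ) (principalSeries (-3 / 2) (-3)).V :=
  LieSubmodule.lieSpan ℂ (Matrix (Fin 3) (Fin 3) ℂ)
    {(principalSeries (-3 / 2) (-3)).vec (1 + 1 + 0) (2 * (-3) + 3 * 1 - 3 * 0) 1}

/-- a cone point of `V(−3/2,−6)` is a `K`-type [cite: Kovacevic2021, §3 Thm 3] -/
private theorem memAntihol {p q : ℤ} (hp : 0 ≤ p) (hq : 0 ≤ q) :
    ((1 + p + q, 2 * (-3) + 3 * p - 3 * q) : ℤ × ℤ) ∈ (principalSeries (-3 / 2) (-3)).S :=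
  mem_cone hp hq rfl rfl

/-- the `K`-types of the sub-datum `N_ray'`: the ray `p = 0` [cite: Kovacevic2021, §4 (`U(0,−6)`)] -/
theorem antihol_ray_mem_iff {p q : ℤ} (hp : 0 ≤ p) (hq : 0 ≤ q) :
    ((1 + p + q, 2 * (-3) + 3 * p - 3 * q) : ℤ × ℤ) ∈ (principalSeries (-3 / 2) (-3)).sqSet ⊥ spanAntiholRay ↔
      p ∈ ({0} : Set ℤ) ∧ q ∈ Set.Ici (0 : ℤ) := by
  rw [mem_sqSet_bot_iff, spanAntiholRay,
    principalSeries_antihol_vec_mem_lieSpan_iff (p₀ := 0) (q₀ := 0) le_rfl le_rfl hp hq, Set.mem_Ici,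
    Set.mem_singleton_iff, and_iff_right (memAntihol hp hq)]
  omega

/-- **`D_0 = U(0,−6)`: the vertex of `V(−3/2,−6)` generates the antiholomorphic discrete series** — the sub-datum of
`N_ray'` has the `K`-types of `antiholDS`, is irreducible, and `N_ray' ≃ antiholDS.V` as `𝔤𝔩(3,ℂ)`-modules.
[cite: Kovacevic2021, §4 (`U(0,−6)`)] [cite: BorelWallach2000, VI 4.10 (10) (`D_0`)] -/
theorem antihol_ray_factor :
    ((principalSeries (-3 / 2) (-3)).subquotient ⊥ spanAntiholRay).S = antiholDS.S ∧
      LieModule.IsIrreducible ℂ (Matrix (Fin 3) (Fin 3) ℂ)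
        ((principalSeries (-3 / 2) (-3)).subquotient ⊥ spanAntiholRay).V ∧
      Nonempty (spanAntiholRay ≃ₗ⁅ℂ, Matrix (Fin 3) (Fin 3) ℂ⁆ antiholDS.V) := by
  have hmem := fun p q (hp : (0 : ℤ) ≤ p) (hq : (0 : ℤ) ≤ q) => antihol_ray_mem_iff hp hq
  have hS : ((principalSeries (-3 / 2) (-3)).subquotient ⊥ spanAntiholRay).S = antiholDS.S :=
    subquotient_principalSeries_S_eq hmem fun n m => by
      rw [mem_antiholDS]
      simp only [Set.mem_Ici, Set.mem_singleton_iff]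
      constructor
      · rintro ⟨h1, h2⟩; exact ⟨0, n - 1, le_rfl, by omega, by omega, by omega, rfl, by omega⟩
      · rintro ⟨p, q, -, hq, rfl, rfl, rfl, -⟩; omega
  have hconn := subquotient_principalSeries_reach Set.ordConnected_singleton Set.ordConnected_Ici
    (by simp) (fun q hq => by simpa only [Set.mem_Ici] using hq) hmem
    (fun p hp hp1 => by simp only [Set.mem_singleton_iff] at hp hp1; omega)
    (fun q hq _ => bcoef_antihol_ne_zero (by simpa only [Set.mem_Ici] using hq))
  obtain ⟨e⟩ := nonempty_equiv_antiholDS_of_S_eq hS hconn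
    fun m h => subquotient_principalSeries_casimirScalar (by norm_num) h
  exact ⟨hS, isIrreducible_of_forall_reach
    (by rw [hS]; exact ⟨(1, -6), (mem_antiholDS 1 (-6)).2 ⟨le_rfl, by norm_num⟩⟩) hconn, ⟨(sqEquivOfBot _ _).trans e⟩⟩

/-- the `K`-types of `N_strip' ⧸ N_ray'`: the column `p = 1` [cite: Kovacevic2021, §3 proof of Thm 3, §4 (`Z(−3)`)] -/
theorem antihol_strip_mem_iff {p q : ℤ} (hp : 0 ≤ p) (hq : 0 ≤ q) :
    ((1 + p + q, 2 * (-3) + 3 * p - 3 * q) : ℤ × ℤ) ∈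
        (principalSeries (-3 / 2) (-3)).sqSet spanAntiholRay spanAntiholStrip ↔
      p ∈ ({1} : Set ℤ) ∧ q ∈ Set.Ici (0 : ℤ) := by
  rw [mem_sqSet_iff, spanAntiholStrip, spanAntiholRay,
    principalSeries_antihol_vec_mem_lieSpan_iff (p₀ := 1) (q₀ := 0) zero_le_one le_rfl hp hq,
    principalSeries_antihol_vec_mem_lieSpan_iff (p₀ := 0) (q₀ := 0) le_rfl le_rfl hp hq, Set.mem_Ici,
    Set.mem_singleton_iff, and_iff_right (memAntihol hp hq)]
  omega

/-- **`J_{0,1} = Z(−3)` is the composition factor `N_strip' ⧸ N_ray'` of `V(−3/2,−6)`** (quotient by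
`ker sqHom = N_ray'.comap N_strip'.incl`). [cite: Kovacevic2021, §4 (`Z(−3)`)] [cite: BorelWallach2000, VI 4.10 (10) (`J_{0,1}`)] -/
theorem antihol_strip_factor :
    ((principalSeries (-3 / 2) (-3)).subquotient spanAntiholRay spanAntiholStrip).S = ladderMinus.S ∧
      LieModule.IsIrreducible ℂ (Matrix (Fin 3) (Fin 3) ℂ)
        ((principalSeries (-3 / 2) (-3)).subquotient spanAntiholRay spanAntiholStrip).V ∧
      Nonempty ((spanAntiholStrip ⧸ ((principalSeries (-3 / 2) (-3)).sqHom spanAntiholRay spanAntiholStrip).ker) ≃ₗ⁅ℂ,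
        Matrix (Fin 3) (Fin 3) ℂ⁆ ladderMinus.V) := by
  have hmem := fun p q (hp : (0 : ℤ) ≤ p) (hq : (0 : ℤ) ≤ q) => antihol_strip_mem_iff hp hq
  have hS : ((principalSeries (-3 / 2) (-3)).subquotient spanAntiholRay spanAntiholStrip).S = ladderMinus.S :=
    subquotient_principalSeries_S_eq hmem fun n m => by
      rw [mem_ladderMinus]
      simp only [Set.mem_Ici, Set.mem_singleton_iff]
      constructor
      · rintro ⟨h1, h2⟩; exact ⟨1, n - 2, zero_le_one, by omega, by omega, by omega, rfl, by omega⟩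
      · rintro ⟨p, q, -, hq, rfl, rfl, rfl, -⟩; omega
  have hconn := subquotient_principalSeries_reach Set.ordConnected_singleton Set.ordConnected_Ici
    (by simp) (fun q hq => by simpa only [Set.mem_Ici] using hq) hmem
    (fun p hp hp1 => by simp only [Set.mem_singleton_iff] at hp hp1; omega)
    (fun q hq _ => bcoef_antihol_ne_zero (by simpa only [Set.mem_Ici] using hq))
  obtain ⟨e⟩ := nonempty_equiv_ladderMinus_of_S_eq hS hconn
  exact ⟨hS, isIrreducible_of_forall_reach
    (by rw [hS]; exact ⟨(2, -3), (mem_ladderMinus 2 (-3)).2 ⟨le_rfl, by norm_num⟩⟩) hconn, ⟨(sqEquiv _ _ _).trans e⟩⟩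

/-- the `K`-types of `V(−3/2,−6) ⧸ N_strip'`: `p ≥ 2` [cite: Kovacevic2021, §3 proof of Thm 3, §4 (`W(3,0)`)] -/
theorem antihol_top_mem_iff {p q : ℤ} (hp : 0 ≤ p) (hq : 0 ≤ q) :
    ((1 + p + q, 2 * (-3) + 3 * p - 3 * q) : ℤ × ℤ) ∈ (principalSeries (-3 / 2) (-3)).sqSet spanAntiholStrip ⊤ ↔
      p ∈ Set.Ici (2 : ℤ) ∧ q ∈ Set.Ici (0 : ℤ) := by
  rw [mem_sqSet_top_iff, spanAntiholStrip,
    principalSeries_antihol_vec_mem_lieSpan_iff (p₀ := 1) (q₀ := 0) zero_le_one le_rfl hp hq, Set.mem_Ici,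
    Set.mem_Ici, and_iff_right (memAntihol hp hq)]
  omega

/-- **`D_1 = W(3,0)` is the top composition factor `V(−3/2,−6) ⧸ N_strip'`** (every `K`-type with `p ≥ 2` generates
`V(−3/2,−6)`). [cite: Kovacevic2021, §4 (`W(3,0)`)] [cite: BorelWallach2000, VI 4.10 (10) (`D_1`)] -/
theorem antihol_top_factor :
    ((principalSeries (-3 / 2) (-3)).subquotient spanAntiholStrip ⊤).S = midDS.S ∧
      LieModule.IsIrreducible ℂ (Matrix (Fin 3) (Fin 3) ℂ)
        ((principalSeries (-3 / 2) (-3)).subquotient spanAntiholStrip ⊤).V ∧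
      Nonempty (((⊤ : LieSubmodule ℂ (Matrix (Fin 3) (Fin 3) ℂ) (principalSeries (-3 / 2) (-3)).V) ⧸
          ((principalSeries (-3 / 2) (-3)).sqHom spanAntiholStrip ⊤).ker) ≃ₗ⁅ℂ, Matrix (Fin 3) (Fin 3) ℂ⁆ midDS.V) := by
  have hmem := fun p q (hp : (0 : ℤ) ≤ p) (hq : (0 : ℤ) ≤ q) => antihol_top_mem_iff hp hq
  have hS : ((principalSeries (-3 / 2) (-3)).subquotient spanAntiholStrip ⊤).S = midDS.S :=
    subquotient_principalSeries_S_eq hmem fun n m => by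
      rw [mem_midDS_iff_int]
      simp only [Set.mem_Ici]
      constructor
      · rintro ⟨p, q, hp, hq, rfl, rfl⟩; exact ⟨p + 1, q - 1, by omega, by omega, by omega, by omega, by omega, by omega⟩
      · rintro ⟨p, q, -, -, rfl, rfl, hp, hq⟩; exact ⟨p - 1, q + 1, by omega, by omega, by omega, by omega⟩
  have hconn := subquotient_principalSeries_reach Set.ordConnected_Ici Set.ordConnected_Ici
    (fun p hp => by simp only [Set.mem_Ici] at hp; omega) (fun q hq => by simpa only [Set.mem_Ici] using hq) hmem
    (fun p hp _ => by rw [Set.mem_Ici] at hp; rw [Ne, acoef_antihol_eq_zero_iff (by omega)]; omega)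
    (fun q hq _ => bcoef_antihol_ne_zero (by simpa only [Set.mem_Ici] using hq))
  obtain ⟨e⟩ := nonempty_equiv_midDS_of_S_eq hS hconn
  exact ⟨hS, isIrreducible_of_forall_reach
    (by rw [hS]; exact ⟨(3, 0), (mem_midDS_iff_int 3 0).2 ⟨1, 1, le_rfl, le_rfl, by norm_num, by norm_num⟩⟩) hconn,
    ⟨(sqEquiv _ _ _).trans e⟩⟩

end SU21Datum

end Literature.RepresentationTheory.Kovacevic2021
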